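import Literature.MathematicalPhysics.QuantumLattice.InfVolFermionState
import HarnessLib

/-!
# Local spin operators and the spin–spin correlator `S_x · S_y` of lattice fermions

Topic `MathematicalPhysics/QuantumLattice` (family `hubbard`). The tree has the TOTAL spin operators
of the Hubbard model (`spinPlus = Σ_x c†_{x↑} c_{x↓}`, `spinMinus`, `HubbardWave0.spinZ`, the Casimir `spinSq`;
Lieb 1989) but not the LOCAL ones. This file defines, for fermions with two spin states
on a finite ordered site set `Λ` (orbitals `Orb Λ = Λ ×ₗ Fin 2`, `0 = ↑`, `1 = ↓`; second
quantisation `creation`/`annihilation` of `HubbardWave0`):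

* `fermionSpinPlus x = c†_{x↑} c_{x↓}` (`S⁺_x`; the torus-specific `siteSpinPlus` of
  `HubbardHubbardModel` is the case `x = FermionTorus.ofTorusSite v`), `fermionSpinMinus x = c†_{x↓} c_{x↑}` (`S⁻_x = (S⁺_x)†`),
  `fermionSpinZ x = ½ (n_{x↑} − n_{x↓})` (`S^z_x`) — Essler–Frahm–Göhmann–Klümper–Korepin, *The
  one-dimensional Hubbard model* (2005), §2.2.5: `S^α_j = ½ Σ_{a,b} c†_{j,a} (σ^α)^a_b c_{j,b}`
  (eq. (2.66) summed over `j` is the total spin; the summand, eq. (2.71)–(2.73) with `j = k`, is the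
  "local spin operator (spin density operator)" `S^α_j = ½ S^α_{jj}`);
* the spin–spin correlator of two sites
  `fermionSpinDot x y = ½ (S⁺_x S⁻_y + S⁻_x S⁺_y) + S^z_x S^z_y` (`= Σ_α S^α_x S^α_y`);
* their images `sPlusAt`, `sMinusAt`, `sZAt`, `spinDotAt` in the local CAR algebra
  `𝔄_Λ = FermionOp Λ` of a finite region `Λ ⊂ ℤ^d` (the vocabulary of `InfVolFermionState`:
  `cAt`, `nAt`), so that an infinite-volume state `ω` has the nearest-neighbour spin correlation
  `ω.expect Λ (spinDotAt 0 _ (unitVec i) _)`.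

API (all proved): the sums over sites are the total operators (`sum_fermionSpinPlus`,
`sum_fermionSpinMinus`, `sum_fermionSpinZ`) and `Σ_x Σ_y S_x·S_y = S²` (`sum_sum_fermionSpinDot`, the tree's
`spinSq`); adjoints (`conjTranspose_fermionSpinPlus`, `…Minus`, `…Z`,
`conjTranspose_fermionSpinDot`); covariance under site bijections `relabel (Orb.mapEquiv f)` and under the
isotony / translation maps `fermionEmbed φ` of the local algebras (`relabel_mapEquiv_fermionSpinDot`,
`fermionEmbed_fermionSpinDot`, `fermionEmbed_incl_spinDotAt`, `fermionEmbed_shiftEmb_spinDotAt`); and the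
NORMAL-ORDERED EXPANSION for distinct sites `x ≠ y`
(`fermionSpinDot_eq_normalOrder`, `spinDotAt_eq_normalOrder`):

  `S_x·S_y = ½ (c†_{x↑} c†_{y↓} c_{y↑} c_{x↓} + c†_{x↓} c†_{y↑} c_{y↓} c_{x↑})`
  `        + ¼ (c†_{x↑} c†_{y↑} c_{y↑} c_{x↑} − c†_{x↑} c†_{y↓} c_{y↓} c_{x↑} − c†_{x↓} c†_{y↑} c_{y↑} c_{x↓} + c†_{x↓} c†_{y↓} c_{y↓} c_{x↓})`

— for `x < y` these six words are normal ordered in the sense "creators with increasing, then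
annihilators with decreasing orbital index" (the word convention of the bundle `pub-mbboot`'s
certificate format `certsdp/1` §1/§6, objective `spin_nn = (1/d) Σ_i S_0·S_{e_i}`), so a
certificate's objective word list can be compared letter by letter with this theorem. Consequences:
`fermionSpinDot x y = fermionSpinDot y x` and `S_x·S_y` is Hermitian (`fermionSpinDot_comm`, `isHermitian_fermionSpinDot`).

Everything is a definition with a body or a proved theorem; no named fact.

## References
* F. H. L. Essler, H. Frahm, F. Göhmann, A. Klümper, V. E. Korepin, *The One-Dimensional Hubbard
  Model*, Cambridge University Press (2005), §2.1 eq. (2.2) (CAR), §2.2.5 eq. (2.66), (2.71)–(2.73)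
  (spin operators). [cite: EsslerEtAl2005, §2.2.5 eq. (2.66) and (2.71)–(2.73)]
* H. Araki, H. Moriya, *Equilibrium statistical mechanics of fermion lattice systems*, Rev. Math.
  Phys. 15 (2003) 93, §4.1 Def. 4.1 (2) (local algebras) and Def. 4.3 (lattice translations).
  [cite: ArakiMoriya2003, §4.1 Def. 4.1 (2) and Def. 4.3]
-/

noncomputable section

namespace Literature.MathematicalPhysics.QuantumLattice

open Matrix Finset HubbardWave0 Literature.Probability.LatticeModels

/-! ### A normal-ordering identity for two hopping words -/

section CAR

variable {ι : Type*} [LinearOrder ι] [Fintype ι]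

/-- `(c†_a c_b)(c†_e c_c) = c†_a c†_e c_c c_b` for `b ≠ e` (move `c†_e` to the left past `c_b`,
then order the two annihilators; CAR, Essler et al. (2005) §2.1 eq. (2.2)).
[cite: EsslerEtAl2005, §2.1 eq. (2.2)] -/
theorem creation_annihilation_mul_creation_annihilation_of_ne {a b e c : ι} (hbe : b ≠ e) :
    creation a * annihilation b * (creation e * annihilation c) =
      creation a * creation e * annihilation c * annihilation b := by
  have h1 : annihilation b * creation e = -(creation e * annihilation b) := by
    rw [annihilation_mul_creation, if_neg hbe, zero_sub]
  have h2 : annihilation b * annihilation c = -(annihilation c * annihilation b) :=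
    eq_neg_of_add_eq_zero_left (annihilation_anticommute_holds b c)
  calc creation a * annihilation b * (creation e * annihilation c)
      = creation a * (annihilation b * creation e) * annihilation c := by noncomm_ring
    _ = -(creation a * creation e * (annihilation b * annihilation c)) := by
        rw [h1]; noncomm_ring
    _ = creation a * creation e * annihilation c * annihilation b := by
        rw [h2]; noncomm_ring

/-- Reordering a normal-ordered four-letter word: `c†_a c†_e c_c c_b = c†_e c†_a c_b c_c` (two sign
flips). [cite: EsslerEtAl2005, §2.1 eq. (2.2)] -/
theorem creation_creation_annihilation_annihilation_swap (a e c b : ι) :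
    creation a * creation e * annihilation c * annihilation b =
      creation e * creation a * annihilation b * annihilation c := by
  have h1 : creation a * creation e = -(creation e * creation a) := creation_mul_creation_eq_neg a e
  have h2 : annihilation c * annihilation b = -(annihilation b * annihilation c) :=
    eq_neg_of_add_eq_zero_left (annihilation_anticommute_holds c b)
  calc creation a * creation e * annihilation c * annihilation b
      = (creation a * creation e) * (annihilation c * annihilation b) := by noncomm_ring
    _ = (-(creation e * creation a)) * (-(annihilation b * annihilation c)) := by rw [h1, h2]
    _ = creation e * creation a * annihilation b * annihilation c := by noncomm_ring

end CAR

/-! ### Local spin operators on a finite ordered site set -/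

section Lattice

variable {Λ Λ' : Type*} [LinearOrder Λ] [Fintype Λ] [LinearOrder Λ'] [Fintype Λ']

/-- **The local spin-raising operator** `S⁺_x = c†_{x↑} c_{x↓}` (Essler et al. (2005) §2.2.5:
`S⁺_j = S^x_j + i S^y_j = c†_{j↑} c_{j↓}` from eq. (2.66)/(2.71)–(2.73)).
[cite: EsslerEtAl2005, §2.2.5 eq. (2.66) and (2.71)–(2.73)] -/
def fermionSpinPlus (x : Λ) : Matrix (Finset (Orb Λ)) (Finset (Orb Λ)) ℂ :=
  creation (orb x 0) * annihilation (orb x 1)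

/-- **The local spin-lowering operator** `S⁻_x = c†_{x↓} c_{x↑} = (S⁺_x)†`.
[cite: EsslerEtAl2005, §2.2.5 eq. (2.66) and (2.71)–(2.73)] -/
def fermionSpinMinus (x : Λ) : Matrix (Finset (Orb Λ)) (Finset (Orb Λ)) ℂ :=
  creation (orb x 1) * annihilation (orb x 0)

/-- **The local `S^z`**: `S^z_x = ½ (n_{x↑} − n_{x↓})`.
[cite: EsslerEtAl2005, §2.2.5 eq. (2.66) and (2.71)–(2.73)] -/
def fermionSpinZ (x : Λ) : Matrix (Finset (Orb Λ)) (Finset (Orb Λ)) ℂ :=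
  (1 / 2 : ℂ) • (numberOp x 0 - numberOp x 1)

/-- **The spin–spin correlator of two sites**,
`S_x · S_y = Σ_α S^α_x S^α_y = ½ (S⁺_x S⁻_y + S⁻_x S⁺_y) + S^z_x S^z_y`.
[cite: EsslerEtAl2005, §2.2.5 eq. (2.66) and (2.71)–(2.73)] -/
def fermionSpinDot (x y : Λ) : Matrix (Finset (Orb Λ)) (Finset (Orb Λ)) ℂ :=
  (1 / 2 : ℂ) • (fermionSpinPlus x * fermionSpinMinus y + fermionSpinMinus x * fermionSpinPlus y) +
    fermionSpinZ x * fermionSpinZ y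

/-- `S⁺_x` unfolded. [cite: EsslerEtAl2005, §2.2.5 eq. (2.66) and (2.71)–(2.73)] -/
theorem fermionSpinPlus_def (x : Λ) :
    fermionSpinPlus x = creation (orb x 0) * annihilation (orb x 1) := rfl

/-- `S⁻_x` unfolded. [cite: EsslerEtAl2005, §2.2.5 eq. (2.66) and (2.71)–(2.73)] -/
theorem fermionSpinMinus_def (x : Λ) :
    fermionSpinMinus x = creation (orb x 1) * annihilation (orb x 0) := rfl

/-- `S^z_x` unfolded. [cite: EsslerEtAl2005, §2.2.5 eq. (2.66) and (2.71)–(2.73)] -/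
theorem fermionSpinZ_def (x : Λ) :
    fermionSpinZ x = (1 / 2 : ℂ) • (numberOp x 0 - numberOp x 1) := rfl

/-- `S_x·S_y` unfolded. [cite: EsslerEtAl2005, §2.2.5 eq. (2.66) and (2.71)–(2.73)] -/
theorem fermionSpinDot_def (x y : Λ) :
    fermionSpinDot x y = (1 / 2 : ℂ) • (fermionSpinPlus x * fermionSpinMinus y + fermionSpinMinus x * fermionSpinPlus y) +
      fermionSpinZ x * fermionSpinZ y := rfl

/-- The local raising operators sum to the total one: `Σ_x S⁺_x = S⁺` (`spinPlus`).
[cite: EsslerEtAl2005, §2.2.5 eq. (2.66)] -/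
theorem sum_fermionSpinPlus :
    ∑ x : Λ, fermionSpinPlus x = (spinPlus : Matrix (Finset (Orb Λ)) (Finset (Orb Λ)) ℂ) := rfl

/-- `Σ_x S⁻_x = S⁻` (`spinMinus`). [cite: EsslerEtAl2005, §2.2.5 eq. (2.66)] -/
theorem sum_fermionSpinMinus :
    ∑ x : Λ, fermionSpinMinus x = (spinMinus : Matrix (Finset (Orb Λ)) (Finset (Orb Λ)) ℂ) := by
  rw [spinMinus_eq_sum]
  rfl

/-- `Σ_x S^z_x = S^z` (`HubbardWave0.spinZ`). [cite: EsslerEtAl2005, §2.2.5 eq. (2.66)] -/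
theorem sum_fermionSpinZ :
    ∑ x : Λ, fermionSpinZ x = (HubbardWave0.spinZ : Matrix (Finset (Orb Λ)) (Finset (Orb Λ)) ℂ) := by
  rw [HubbardWave0.spinZ, Finset.smul_sum]
  rfl

/-- **Consistency with the total spin**: `Σ_x Σ_y S_x·S_y = S²` (the tree's Casimir `spinSq` of
Lieb's theorem, `spinSq = (S^z)² + ½ (S⁺S⁻ + S⁻S⁺)`). [cite: EsslerEtAl2005, §2.2.5 eq. (2.66)] -/
theorem sum_sum_fermionSpinDot :
    ∑ x : Λ, ∑ y : Λ, fermionSpinDot x y = (spinSq : Matrix (Finset (Orb Λ)) (Finset (Orb Λ)) ℂ) := by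
  have hm : ((spinPlus : Matrix (Finset (Orb Λ)) (Finset (Orb Λ)) ℂ)ᴴ) = ∑ x : Λ, fermionSpinMinus x := by
    rw [sum_fermionSpinMinus]
    rfl
  rw [spinSq, ← sum_fermionSpinZ, hm, ← sum_fermionSpinPlus]
  simp only [fermionSpinDot, Finset.sum_add_distrib, Finset.sum_mul_sum, ← Finset.smul_sum]
  abel

/-- `(S⁺_x)† = S⁻_x`. [cite: EsslerEtAl2005, §2.2.5 eq. (2.66) and (2.71)–(2.73)] -/
@[simp] theorem conjTranspose_fermionSpinPlus (x : Λ) : (fermionSpinPlus x)ᴴ = fermionSpinMinus x := by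
  rw [fermionSpinPlus, fermionSpinMinus, conjTranspose_mul, creation_conjTranspose,
    annihilation_conjTranspose]

/-- `(S⁻_x)† = S⁺_x`. [cite: EsslerEtAl2005, §2.2.5 eq. (2.66) and (2.71)–(2.73)] -/
@[simp] theorem conjTranspose_fermionSpinMinus (x : Λ) : (fermionSpinMinus x)ᴴ = fermionSpinPlus x := by
  rw [fermionSpinPlus, fermionSpinMinus, conjTranspose_mul, creation_conjTranspose,
    annihilation_conjTranspose]

/-- `(S^z_x)† = S^z_x` (`n_{xσ}` is self-adjoint, `numberAt_isHermitian`). [cite: EsslerEtAl2005, §2.2.5 eq. (2.66) and (2.71)–(2.73)] -/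
@[simp] theorem conjTranspose_fermionSpinZ (x : Λ) : (fermionSpinZ x)ᴴ = fermionSpinZ x := by
  have hn : ∀ τ : Fin 2, (numberOp x τ)ᴴ = numberOp x τ := fun τ => (numberAt_isHermitian (orb x τ)).eq
  rw [fermionSpinZ, conjTranspose_smul, conjTranspose_sub, hn, hn]
  norm_num

/-- `(S_x·S_y)† = S_y·S_x`. [cite: EsslerEtAl2005, §2.2.5 eq. (2.66) and (2.71)–(2.73)] -/
theorem conjTranspose_fermionSpinDot (x y : Λ) : (fermionSpinDot x y)ᴴ = fermionSpinDot y x := by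
  rw [fermionSpinDot, fermionSpinDot, conjTranspose_add, conjTranspose_smul, conjTranspose_add,
    conjTranspose_mul, conjTranspose_mul, conjTranspose_mul, conjTranspose_fermionSpinPlus,
    conjTranspose_fermionSpinMinus, conjTranspose_fermionSpinPlus, conjTranspose_fermionSpinMinus,
    conjTranspose_fermionSpinZ, conjTranspose_fermionSpinZ, add_comm (fermionSpinPlus y * fermionSpinMinus x)]
  norm_num

/-! #### Covariance under site bijections and under the isotony maps of the local algebras -/

/-- `Γ(f) S⁺_x Γ(f)⁻¹ = S⁺_{f x}` (covariance of the local algebras under site bijections). [cite: ArakiMoriya2003, §4.1 Def. 4.1 (2) and Def. 4.3] -/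
theorem relabel_mapEquiv_fermionSpinPlus (f : Λ ≃ Λ') (x : Λ) :
    relabel (Orb.mapEquiv f) (fermionSpinPlus x) = fermionSpinPlus (f x) := by
  rw [fermionSpinPlus, fermionSpinPlus, map_mul, relabel_creation, relabel_annihilation,
    Orb.mapEquiv_orb, Orb.mapEquiv_orb]

/-- `Γ(f) S⁻_x Γ(f)⁻¹ = S⁻_{f x}`. [cite: ArakiMoriya2003, §4.1 Def. 4.1 (2) and Def. 4.3] -/
theorem relabel_mapEquiv_fermionSpinMinus (f : Λ ≃ Λ') (x : Λ) :
    relabel (Orb.mapEquiv f) (fermionSpinMinus x) = fermionSpinMinus (f x) := by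
  rw [fermionSpinMinus, fermionSpinMinus, map_mul, relabel_creation, relabel_annihilation,
    Orb.mapEquiv_orb, Orb.mapEquiv_orb]

/-- `Γ(f) S^z_x Γ(f)⁻¹ = S^z_{f x}`. [cite: ArakiMoriya2003, §4.1 Def. 4.1 (2) and Def. 4.3] -/
theorem relabel_mapEquiv_fermionSpinZ (f : Λ ≃ Λ') (x : Λ) :
    relabel (Orb.mapEquiv f) (fermionSpinZ x) = fermionSpinZ (f x) := by
  rw [fermionSpinZ, fermionSpinZ, map_smul, map_sub, relabel_mapEquiv_numberOp, relabel_mapEquiv_numberOp]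

/-- `Γ(f) (S_x·S_y) Γ(f)⁻¹ = S_{f x}·S_{f y}`. [cite: ArakiMoriya2003, §4.1 Def. 4.1 (2) and Def. 4.3] -/
theorem relabel_mapEquiv_fermionSpinDot (f : Λ ≃ Λ') (x y : Λ) :
    relabel (Orb.mapEquiv f) (fermionSpinDot x y) = fermionSpinDot (f x) (f y) := by
  simp only [fermionSpinDot, map_add, map_smul, map_mul, relabel_mapEquiv_fermionSpinPlus,
    relabel_mapEquiv_fermionSpinMinus, relabel_mapEquiv_fermionSpinZ]

/-- Isotony / covariance of the local algebras on `S⁺_x`: `Γ(φ) S⁺_x = S⁺_{φ x}`. [cite: ArakiMoriya2003, §4.1 Def. 4.1 (2) and Def. 4.3] -/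
theorem fermionEmbed_fermionSpinPlus (φ : Λ ↪ Λ') (x : Λ) :
    fermionEmbed φ (fermionSpinPlus x) = fermionSpinPlus (φ x) := by
  rw [fermionSpinPlus, fermionSpinPlus, map_mul, fermionEmbed_creation, fermionEmbed_annihilation]

/-- `Γ(φ) S⁻_x = S⁻_{φ x}`. [cite: ArakiMoriya2003, §4.1 Def. 4.1 (2) and Def. 4.3] -/
theorem fermionEmbed_fermionSpinMinus (φ : Λ ↪ Λ') (x : Λ) :
    fermionEmbed φ (fermionSpinMinus x) = fermionSpinMinus (φ x) := by
  rw [fermionSpinMinus, fermionSpinMinus, map_mul, fermionEmbed_creation, fermionEmbed_annihilation]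

/-- `Γ(φ) S^z_x = S^z_{φ x}`. [cite: ArakiMoriya2003, §4.1 Def. 4.1 (2) and Def. 4.3] -/
theorem fermionEmbed_fermionSpinZ (φ : Λ ↪ Λ') (x : Λ) :
    fermionEmbed φ (fermionSpinZ x) = fermionSpinZ (φ x) := by
  rw [fermionSpinZ, fermionSpinZ, map_smul, map_sub, fermionEmbed_numberOp, fermionEmbed_numberOp]

/-- `Γ(φ) (S_x·S_y) = S_{φ x}·S_{φ y}`. [cite: ArakiMoriya2003, §4.1 Def. 4.1 (2) and Def. 4.3] -/
theorem fermionEmbed_fermionSpinDot (φ : Λ ↪ Λ') (x y : Λ) :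
    fermionEmbed φ (fermionSpinDot x y) = fermionSpinDot (φ x) (φ y) := by
  simp only [fermionSpinDot, map_add, map_smul, map_mul, fermionEmbed_fermionSpinPlus,
    fermionEmbed_fermionSpinMinus, fermionEmbed_fermionSpinZ]

/-! #### The normal-ordered expansion -/

omit [LinearOrder Λ] [Fintype Λ] in
/-- Distinct sites have distinct orbitals. [folklore] -/
private theorem orb_ne_orb_of_ne {x y : Λ} (hxy : x ≠ y) (σ τ : Fin 2) : orb x σ ≠ orb y τ := by
  intro h
  exact hxy (congrArg Prod.fst (toLex.injective h))

/-- **Normal-ordered expansion of the spin–spin correlator** of two distinct sites: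
`S_x·S_y = ½ (c†_{x↑} c†_{y↓} c_{y↑} c_{x↓} + c†_{x↓} c†_{y↑} c_{y↓} c_{x↑})`
`+ ¼ (c†_{x↑} c†_{y↑} c_{y↑} c_{x↑} − c†_{x↑} c†_{y↓} c_{y↓} c_{x↑} − c†_{x↓} c†_{y↑} c_{y↑} c_{x↓} + c†_{x↓} c†_{y↓} c_{y↓} c_{x↓})`
(CAR only; for `x < y` each word has its creators in increasing and its annihilators in
decreasing orbital order `x↑ < x↓ < y↑ < y↓`). [cite: EsslerEtAl2005, §2.1 eq. (2.2) and §2.2.5 eq. (2.66)] -/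
theorem fermionSpinDot_eq_normalOrder {x y : Λ} (hxy : x ≠ y) :
    fermionSpinDot x y =
      (1 / 2 : ℂ) • (creation (orb x 0) * creation (orb y 1) * annihilation (orb y 0) * annihilation (orb x 1) +
          creation (orb x 1) * creation (orb y 0) * annihilation (orb y 1) * annihilation (orb x 0)) +
        (1 / 4 : ℂ) • (creation (orb x 0) * creation (orb y 0) * annihilation (orb y 0) * annihilation (orb x 0) -
          creation (orb x 0) * creation (orb y 1) * annihilation (orb y 1) * annihilation (orb x 0) -
          creation (orb x 1) * creation (orb y 0) * annihilation (orb y 0) * annihilation (orb x 1) +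
          creation (orb x 1) * creation (orb y 1) * annihilation (orb y 1) * annihilation (orb x 1)) := by
  have h := fun (σ τ : Fin 2) => orb_ne_orb_of_ne hxy σ τ
  simp only [fermionSpinDot, fermionSpinPlus, fermionSpinMinus, fermionSpinZ, numberOp, smul_sub, mul_sub, sub_mul,
    smul_mul_assoc, mul_smul_comm, creation_annihilation_mul_creation_annihilation_of_ne (h _ _)]
  module

/-- `S_x·S_y = S_y·S_x` (from the normal-ordered expansion and the CAR). [cite: EsslerEtAl2005, §2.1 eq. (2.2) and §2.2.5 eq. (2.66)] -/
theorem fermionSpinDot_comm (x y : Λ) : fermionSpinDot x y = fermionSpinDot y x := by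
  rcases eq_or_ne x y with rfl | hxy
  · rfl
  rw [fermionSpinDot_eq_normalOrder hxy, fermionSpinDot_eq_normalOrder hxy.symm,
    creation_creation_annihilation_annihilation_swap (orb y 0) (orb x 1),
    creation_creation_annihilation_annihilation_swap (orb y 1) (orb x 0),
    creation_creation_annihilation_annihilation_swap (orb y 0) (orb x 0),
    creation_creation_annihilation_annihilation_swap (orb y 0) (orb x 1),
    creation_creation_annihilation_annihilation_swap (orb y 1) (orb x 0),
    creation_creation_annihilation_annihilation_swap (orb y 1) (orb x 1)]
  module

/-- **`S_x·S_y` is Hermitian.** [cite: EsslerEtAl2005, §2.1 eq. (2.2) and §2.2.5 eq. (2.66)] -/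
theorem isHermitian_fermionSpinDot (x y : Λ) : (fermionSpinDot x y).IsHermitian := by
  rw [IsHermitian, conjTranspose_fermionSpinDot, fermionSpinDot_comm]

end Lattice

/-! ### In the local CAR algebra `𝔄_Λ` of a region `Λ ⊂ ℤ^d` -/

section Window

variable {d : ℕ}

/-- `S⁺_x ∈ 𝔄_Λ` for a site `x ∈ Λ`. [cite: EsslerEtAl2005, §2.2.5 eq. (2.66) and (2.71)–(2.73)] -/
abbrev sPlusAt {Λ : Finset (Site d)} (x : Site d) (hx : x ∈ Λ) : FermionOp Λ :=
  fermionSpinPlus (PolySite.pt x hx)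

/-- `S⁻_x ∈ 𝔄_Λ`. [cite: EsslerEtAl2005, §2.2.5 eq. (2.66) and (2.71)–(2.73)] -/
abbrev sMinusAt {Λ : Finset (Site d)} (x : Site d) (hx : x ∈ Λ) : FermionOp Λ :=
  fermionSpinMinus (PolySite.pt x hx)

/-- `S^z_x ∈ 𝔄_Λ`. [cite: EsslerEtAl2005, §2.2.5 eq. (2.66) and (2.71)–(2.73)] -/
abbrev sZAt {Λ : Finset (Site d)} (x : Site d) (hx : x ∈ Λ) : FermionOp Λ :=
  fermionSpinZ (PolySite.pt x hx)

/-- **The spin–spin correlator `S_x·S_y ∈ 𝔄_Λ`** of two sites of a region (the observable of the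
nearest-neighbour spin correlation `ω(S_0·S_{e_i})` of an infinite-volume state `ω`).
[cite: EsslerEtAl2005, §2.2.5 eq. (2.66) and (2.71)–(2.73)] -/
abbrev spinDotAt {Λ : Finset (Site d)} (x : Site d) (hx : x ∈ Λ) (y : Site d) (hy : y ∈ Λ) :
    FermionOp Λ :=
  fermionSpinDot (PolySite.pt x hx) (PolySite.pt y hy)

/-- Isotony: `Γ(Λ ⊆ Λ') (S_x·S_y) = S_x·S_y`. [cite: ArakiMoriya2003, §4.1 Def. 4.1 (2) and Def. 4.3] -/
theorem fermionEmbed_incl_spinDotAt {Λ Λ' : Finset (Site d)} (h : Λ ⊆ Λ') (x : Site d) (hx : x ∈ Λ)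
    (y : Site d) (hy : y ∈ Λ) :
    fermionEmbed (PolySite.incl h) (spinDotAt x hx y hy) = spinDotAt x (h hx) y (h hy) :=
  fermionEmbed_fermionSpinDot _ _ _

/-- Translation covariance: `Γ(τ_v) (S_x·S_y) = S_{x+v}·S_{y+v}` (`τ_k(𝔄(I)) = 𝔄(I + k)`). [cite: ArakiMoriya2003, §4.1 Def. 4.1 (2) and Def. 4.3] -/
theorem fermionEmbed_shiftEmb_spinDotAt (v : Site d) {Λ : Finset (Site d)} (x : Site d) (hx : x ∈ Λ)
    (y : Site d) (hy : y ∈ Λ) :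
    fermionEmbed (PolySite.shiftEmb v Λ) (spinDotAt x hx y hy) =
      spinDotAt (x + v) (PolySite.add_mem_shiftSet v hx) (y + v) (PolySite.add_mem_shiftSet v hy) :=
  fermionEmbed_fermionSpinDot _ _ _

/-- Distinct sites of a region are distinct ordered sites. [folklore] -/
private theorem pt_ne_pt {Λ : Finset (Site d)} {x y : Site d} (hxy : x ≠ y) (hx : x ∈ Λ) (hy : y ∈ Λ) :
    PolySite.pt x hx ≠ PolySite.pt y hy := by
  intro h
  exact hxy (by simpa using congrArg (fun z : PolySite Λ => ofLex z.1) h)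

/-- **Normal-ordered expansion of `S_x·S_y ∈ 𝔄_Λ` in the generators `c_{zσ} = cAt z _ σ`**
(`x ≠ y`; the word list of the certificate objective `spin_nn`, format `certsdp/1` §1/§6 of the
bundle `pub-mbboot`, up to the factor `1/d` and the sum over the `d` bond directions).
[cite: EsslerEtAl2005, §2.1 eq. (2.2) and §2.2.5 eq. (2.66)] -/
theorem spinDotAt_eq_normalOrder {Λ : Finset (Site d)} {x y : Site d} (hxy : x ≠ y) (hx : x ∈ Λ)
    (hy : y ∈ Λ) :
    spinDotAt x hx y hy =
      (1 / 2 : ℂ) • ((cAt x hx 0)ᴴ * (cAt y hy 1)ᴴ * cAt y hy 0 * cAt x hx 1 +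
          (cAt x hx 1)ᴴ * (cAt y hy 0)ᴴ * cAt y hy 1 * cAt x hx 0) +
        (1 / 4 : ℂ) • ((cAt x hx 0)ᴴ * (cAt y hy 0)ᴴ * cAt y hy 0 * cAt x hx 0 -
          (cAt x hx 0)ᴴ * (cAt y hy 1)ᴴ * cAt y hy 1 * cAt x hx 0 -
          (cAt x hx 1)ᴴ * (cAt y hy 0)ᴴ * cAt y hy 0 * cAt x hx 1 +
          (cAt x hx 1)ᴴ * (cAt y hy 1)ᴴ * cAt y hy 1 * cAt x hx 1) := by
  simp only [cAt, annihilation_conjTranspose]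
  exact fermionSpinDot_eq_normalOrder (pt_ne_pt hxy hx hy)

end Window

end Literature.MathematicalPhysics.QuantumLattice
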